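import Literature.NumberTheory.Rogawski1990.UnitOrbitalIntegralInertValueThetaZeroClosed
import Literature.NumberTheory.Automorphic.UnitaryThreeBorelCosetCountJZeroHigh
import HarnessLib

/-!
# LAYER C, `θ̄ = 0`, COMPLETE: the case-(e) count discharged — `#{q ∈ U⧸K : t(a,b,c)·q = q} = φ₀(N₁, N₂, N)` unconditionally
(Flicker (1998), *Elementary proof of the fundamental lemma for a unitary group*, Prop. 13 p. 93 case (e); Prop. 14 p. 94)

Topic `NumberTheory/Rogawski1990` (road «D-N7-inert», MAP v3 LAYER C, value `X₁`); namespace `Literature.NumberTheory.Automorphic.UnitaryGroup`.  THEOREMS ONLY;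
kernel lane.  Pen F0P3b-p01 (g6).  HONEST LABEL: HC_CM is proved only modulo the 2 remaining named inputs (hLiu418, h413) until rung 0 closes; this file removes
the last named input (`hce`) of the `θ̄ = 0` value by ★ `natCard_cosets_of_iff_norm_sub_le_high` (precision `2m − N ≤ m + ℓ`, A-p03 (g24) 05:41:12Z).

* `natCard_cosets_flickerTorusOne_case_e` — Prop. 13 case (e) at the torus literal: for `N < m`, `M < 2m ≤ M + N`, `M − N` even (`M = max N₁ N₂`), the coset count is
  `(q+1)² q^{2m+N−2}` (Flicker's `(1+q⁻¹)² q^{2m+N}` after Prop. 8's `q^m`), GIVEN CORE-0's pointwise criterion — exactly the `hce` clause of ★ T1b∕T2.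
* **`natCard_fixedPoints_unitaryInt_flickerTorusOne_eq_phiZero`** — ★ T2 `…_of_bridge` with `hce` discharged: the `θ̄ = 0` VALUE `X₁` with only frame∕bridge data.

## References
* [Flicker1998UnitaryFL] Y. Z. Flicker, *Elementary proof of the fundamental lemma for a unitary group*, Canad. J. Math. 50 (1998), 74–98.
* [Rogawski1990] J. D. Rogawski, *Automorphic Representations of Unitary Groups in Three Variables* (1990), §4.9 p. 55.
-/

set_option autoImplicit false

open scoped MatrixGroups WithZero Valued
open Matrix

namespace Literature.NumberTheory.Automorphic

namespace UnitaryGroup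

open Literature.NumberTheory.Automorphic.HermitianLattice (unitaryInt mem_unitaryInt_iff LocalConjDatum)
open Literature.NumberTheory.Rogawski1990.Flicker1998 (phiZero)
open IsLocalRing

universe u

variable {K : Type*} [Field K] [Valued K ℤᵐ⁰] {ϖ : K} (σ : K →+* K) {J : Matrix (Fin 3) (Fin 3) K}

section Complete

variable [IsDiscreteValuationRing 𝒪[K]] [Finite (ResidueField 𝒪[K])] [IsAdicComplete (maximalIdeal 𝒪[K]) 𝒪[K]]

/-- **PROP. 13, CASE (e), at the torus literal** (the `hce` clause of ★ `natCard_cosets_flickerTorusOne_eq_iThirteen_all`, PROVED): for `N < m`, `N ≤ N₊`,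
`max N₁ N₂ < 2m ≤ max N₁ N₂ + N`, `max N₁ N₂ − N` even, and CORE-0's pointwise criterion, `#{good cosets} = (q+1)²·q^{2m+N−2}` — ★ `natCard_cosets_of_iff_norm_sub_le_high`
at `j = 2m − N ≤ m + ℓ`, `2ℓ = M − N`, `γ = (f²−1)∕ϖ^{2ℓ}`, `f = −e(r+σr)`. [cite: Flicker1998UnitaryFL, Prop. 13 p. 93] -/
theorem natCard_cosets_flickerTorusOne_case_e (hJ : J = (StdForm.antidiagonal 3).over K) (hd : LocalConjDatum σ ϖ)
    (hσO : ∀ y : 𝒪[K], (σ.comp 𝒪[K].subtype) y ∈ 𝒪[K]) {y : K} (hy : y * σ y = -2)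
    {c um t : ↥(unitaryGroupOfForm σ J)} (hc : ((c : GL (Fin 3) K) : Matrix (Fin 3) (Fin 3) K) = !![1, 0, 0; 0, -1, 0; 0, 0, 1])
    {m : ℕ} (hum : ((um : GL (Fin 3) K) : Matrix (Fin 3) (Fin 3) K) = !![ϖ ^ m, y, (ϖ ^ m)⁻¹; 0, 1, -σ y * (ϖ ^ m)⁻¹; 0, 0, (ϖ ^ m)⁻¹])
    {e a b cc : K} (h2e : 2 * e = 1) (ha : σ a * a = 1) (hb : σ b * b = 1) (hcc : σ cc * cc = 1)
    {N Np N₁ N₂ : ℕ} (hN : Valued.v (a - cc) = Valued.v (ϖ ^ N)) (hNp : Valued.v (a + cc - 2 * b) = Valued.v (ϖ ^ Np))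
    (hN₁ : Valued.v (a - b) = Valued.v (ϖ ^ N₁)) (hN₂ : Valued.v (cc - b) = Valued.v (ϖ ^ N₂))
    (h : (N₁ < N ∧ N₂ = N₁ ∧ Np = N₁) ∨ (N ≤ N₁ ∧ N ≤ Np))
    {q : ℕ} (hq : Nat.card (ResidueField 𝒪[K]) = q ^ 2)
    {a₀ : 𝒪[K]} (ha₀ : IsUnit (((σ.comp 𝒪[K].subtype).codRestrict 𝒪[K] hσO) a₀ - a₀))
    (hNm : N < m) (hNNp : N ≤ Np) (hM2 : max N₁ N₂ < 2 * m) (h2M : 2 * m ≤ max N₁ N₂ + N) (hpar : (max N₁ N₂ - N) % 2 = 0)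
    (hcrit : ∀ p ∈ flickerPH σ J c, ∀ u' x w : K,
        ((p : GL (Fin 3) K) : Matrix (Fin 3) (Fin 3) K) = !![u', 0, u' * x; 0, w, 0; 0, 0, (σ u')⁻¹] →
          (p⁻¹ * t * p ∈ flickerHK σ J c um ↔
            Valued.v (((u' * σ u')⁻¹ + -(e * ((a + cc - 2 * b) / (a - cc) + σ ((a + cc - 2 * b) / (a - cc)))) + x) * σ ((u' * σ u')⁻¹ + -(e * ((a + cc - 2 * b) / (a - cc) + σ ((a + cc - 2 * b) / (a - cc)))) + x) - ((-(e * ((a + cc - 2 * b) / (a - cc) + σ ((a + cc - 2 * b) / (a - cc))))) ^ 2 - 1)) ≤ Valued.v (ϖ ^ (2 * m - N)))) :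
    Nat.card {w : ↥(flickerPH σ J c) ⧸ (flickerHK σ J c um).subgroupOf (flickerPH σ J c) //
      ((Quotient.out w : ↥(flickerPH σ J c)) : ↥(unitaryGroupOfForm σ J))⁻¹ * t * (Quotient.out w : ↥(flickerPH σ J c)) ∈ flickerHK σ J c um} =
      (q + 1) ^ 2 * q ^ (2 * m + N - 2) := by
  have h2v : Valued.v (2 : K) = 1 := hd.v2
  have h2 : (2 : K) ≠ 0 := fun h => by rw [h, map_zero] at h2v; exact zero_ne_one h2v
  have hϖ0 : ϖ ≠ 0 := hd.ϖ_ne_zero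
  have he0 : e ≠ 0 := fun h => by rw [h, mul_zero] at h2e; exact zero_ne_one h2e
  have hve : Valued.v e = 1 := by
    have := congrArg Valued.v h2e; rw [map_mul, h2v, one_mul, map_one] at this; exact this
  have ha0 : a ≠ 0 := fun h => by rw [h, mul_zero] at ha; exact zero_ne_one ha
  have hb0 : b ≠ 0 := fun h => by rw [h, mul_zero] at hb; exact zero_ne_one hb
  have hc0 : cc ≠ 0 := fun h => by rw [h, mul_zero] at hcc; exact zero_ne_one hcc
  have hvb : Valued.v b = 1 := by
    have h1 := congrArg Valued.v hb; rw [map_mul, hd.vσ, map_one] at h1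
    exact Literature.NumberTheory.QuadraticForms.OMeara65.WithZeroMulInt.eq_one_of_mul_self h1
  have hac : a ≠ cc := by
    intro h; rw [h, sub_self, map_zero] at hN; exact (pow_ne_zero _ hϖ0) ((map_eq_zero _).1 hN.symm)
  have hac' : a - cc ≠ 0 := sub_ne_zero.2 hac
  have vle : ∀ {i j : ℕ}, Valued.v (ϖ ^ i) ≤ Valued.v (ϖ ^ j) ↔ j ≤ i := fun {i j} => by rw [hd.v_pow, hd.v_pow, WithZero.exp_le_exp]; omega
  have vlt : ∀ {i j : ℕ}, Valued.v (ϖ ^ i) < Valued.v (ϖ ^ j) ↔ j < i := fun {i j} => by rw [hd.v_pow, hd.v_pow, WithZero.exp_lt_exp]; omega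
  -- type B and `min(N₁,N₂) = N`
  have hN1 : 1 ≤ N := by omega
  have hm : 1 ≤ m := by omega
  have hNle : N ≤ N₁ := by
    rcases h with ⟨h1, -, h3⟩ | ⟨h1, -⟩
    · exact absurd hNNp (by omega)
    · exact h1
  have hsum : N₁ + N₂ = N + max N₁ N₂ := by
    have hs : a - cc = (a - b) + (b - cc) := by ring
    have hvbc : Valued.v (b - cc) = Valued.v (ϖ ^ N₂) := by rw [← Valuation.map_sub_swap, hN₂]
    rcases lt_trichotomy N₁ N₂ with hlt | heq | hgt
    · have : Valued.v (a - cc) = Valued.v (a - b) := by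
        rw [hs]; exact Valuation.map_add_eq_of_lt_left _ (by rw [hvbc, hN₁, vlt]; exact hlt)
      rw [hN, hN₁, hd.v_pow, hd.v_pow, WithZero.exp_inj] at this
      rw [max_eq_right hlt.le]; omega
    · subst heq
      have hle : Valued.v (a - cc) ≤ Valued.v (ϖ ^ N₁) := by
        rw [hs]; exact le_trans (Valuation.map_add _ _ _) (max_le (le_of_eq hN₁) (le_of_eq hvbc))
      rw [hN, vle] at hle
      rw [max_self]; omega
    · have : Valued.v (a - cc) = Valued.v (b - cc) := by
        rw [hs]; exact Valuation.map_add_eq_of_lt_right _ (by rw [hvbc, hN₁, vlt]; exact hgt)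
      rw [hN, hvbc, hd.v_pow, hd.v_pow, WithZero.exp_inj] at this
      rw [max_eq_left hgt.le]; omega
  -- the split `(A − b)∕B = f + g`
  have hσa : σ a = a⁻¹ := eq_inv_of_mul_eq_one_left ha
  have hσb : σ b = b⁻¹ := eq_inv_of_mul_eq_one_left hb
  have hσc : σ cc = cc⁻¹ := eq_inv_of_mul_eq_one_left hcc
  set r : K := (a + cc - 2 * b) / (a - cc) with hr
  have hσrr : σ r - r = 2 * (a - b) * (cc - b) / (b * (a - cc)) := map_ratio_sub_ratio σ hσa hσb hσc ha0 hb0 hc0 hac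
  set f : K := -(e * (r + σ r)) with hf
  set g : K := e * (σ r - r) with hg
  have he2 : e = (2 : K)⁻¹ := by rw [← one_div, eq_div_iff h2, mul_comm]; exact h2e
  have hσe : σ e = e := by rw [he2, map_inv₀, map_ofNat]
  have hσf : σ f = f := by rw [hf, map_neg, map_mul, map_add, hd.σσ, hσe, add_comm]
  have hvr : Valued.v r ≤ 1 := by
    rw [hr, map_div₀, hNp, hN, hd.v_pow, hd.v_pow, ← WithZero.exp_sub, ← WithZero.exp_zero, WithZero.exp_le_exp]; omega
  have hvσr : Valued.v (σ r) ≤ 1 := by rw [hd.vσ]; exact hvr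
  have hf1 : Valued.v f ≤ 1 := by
    rw [hf, Valuation.map_neg, map_mul, hve, one_mul]
    exact le_trans (Valuation.map_add _ _ _) (max_le hvr hvσr)
  have hvgM : Valued.v g = Valued.v (ϖ ^ max N₁ N₂) := by
    rw [hg, map_mul, hve, one_mul, hσrr, map_div₀, map_mul, map_mul, map_mul, h2v, one_mul, hvb, one_mul, hN₁, hN₂, hN,
      hd.v_pow, hd.v_pow, hd.v_pow, hd.v_pow, ← WithZero.exp_add, ← WithZero.exp_sub, WithZero.exp_inj]
    omega
  have hr2 : Valued.v (r ^ 2 - 1) = Valued.v (ϖ ^ (max N₁ N₂ - N)) := by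
    rw [hr, ratio_sq_sub_one hac', map_div₀, map_mul, map_mul, map_pow, show (4 : K) = 2 * 2 by norm_num, map_mul, h2v, one_mul, one_mul,
      hN₁, hN₂, hN, hd.v_pow, hd.v_pow, hd.v_pow, hd.v_pow, ← WithZero.exp_add, ← WithZero.exp_nsmul, ← WithZero.exp_sub, WithZero.exp_inj]
    simp only [nsmul_eq_mul, Nat.cast_ofNat]; omega
  have hfr : f = -r + (-g) := by rw [hf, hg]; linear_combination (-(r : K)) * h2e
  have hf2 : f ^ 2 - 1 = (r ^ 2 - 1) + g * (2 * r + g) := by rw [hfr]; ring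
  have h2r : Valued.v (2 * r + g) ≤ 1 := le_trans (Valuation.map_add _ _ _)
    (max_le (by rw [map_mul, h2v, one_mul]; exact hvr) (by rw [hvgM]; exact hd.v_pow_le_one _))
  have hsmall : Valued.v (g * (2 * r + g)) < Valued.v (r ^ 2 - 1) := by
    rw [hr2, map_mul, hvgM]
    exact lt_of_le_of_lt (mul_le_of_le_one_right zero_le h2r) (by rw [vlt]; omega)
  have hc₁ : Valued.v (f ^ 2 - 1) = Valued.v (ϖ ^ (max N₁ N₂ - N)) := by
    rw [hf2, Valuation.map_add_eq_of_lt_left _ hsmall, hr2]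
  -- `f² − 1 = ϖ^{2ℓ}·γ`
  obtain ⟨ℓ, hℓ⟩ : ∃ ℓ, max N₁ N₂ - N = 2 * ℓ := ⟨(max N₁ N₂ - N) / 2, by omega⟩
  obtain ⟨γ, hγdef⟩ : ∃ γ : K, γ = (f ^ 2 - 1) / ϖ ^ (2 * ℓ) := ⟨_, rfl⟩
  have hγ : Valued.v γ = 1 := by
    rw [hγdef, map_div₀, hc₁, hℓ, div_self (Valuation.ne_zero_iff _ |>.2 (pow_ne_zero _ hϖ0))]
  have hσγ : σ γ = γ := by rw [hγdef, map_div₀, map_sub, map_pow, map_pow, hσf, hd.σϖ, map_one]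
  have hec : f ^ 2 - 1 = ϖ ^ (2 * ℓ) * γ := by rw [hγdef, ← mul_div_assoc, mul_div_cancel_left₀ _ (pow_ne_zero _ hϖ0)]
  have hj : 2 * ℓ < 2 * m - N := by omega
  have hjm : 2 * m - N ≤ m + ℓ := by omega
  -- Prop. 8's numbers (★ B-p04's package) and ★ the high-precision junction
  haveI := finite_quotient_flickerHK σ hJ hd hy hσO m hum hc hq ha₀
  have hcount := natCard_cosets_of_iff_norm_sub_le_high σ hJ hd hσO hm hj hjm hc hf1 hσf hγ hσγ hec hcrit hq ha₀
    (inf_flickerHK_le_flickerPH0 σ hJ hd hy m hum hc) (natCard_fibre_flickerPHRho_eq σ hJ hd hy hσO m hum hc hq ha₀)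
  rw [hcount]
  -- exponent bookkeeping: `m = ℓ + 1 + r'`, `N + ℓ = m + s'`
  obtain ⟨r', hr'⟩ : ∃ r', m = ℓ + 1 + r' := ⟨m - ℓ - 1, by omega⟩
  obtain ⟨s', hs'⟩ : ∃ s', N + ℓ = m + s' := ⟨N + ℓ - m, by omega⟩
  rw [show m - ℓ - (2 * m - N - 2 * ℓ) = s' by omega, show m - ℓ - 1 = r' by omega, show m - 1 = ℓ + r' by omega,
    show 2 * m + N - 2 = (ℓ + 1 + r') + (ℓ + r') + s' + r' by omega, hr']
  ring

set_option synthInstance.maxHeartbeats 200000 in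
-- the `H`-action on `H ⧸ (K^{u_m} ∩ H)` is found through the large subgroup terms of the `U(2,1)` frame (as in ★ (F2))
/-- **THE `θ̄ = 0` VALUE, COMPLETE**: for `t = t(a,b,c)`, `#{q ∈ U⧸K : t q = q} = phiZero q N₁ N₂ N` with ONLY frame∕bridge data as hypotheses
(★ `…_of_bridge` with the case-(e) clause discharged by `natCard_cosets_flickerTorusOne_case_e`). [cite: Flicker1998UnitaryFL, Prop. 5 p. 82; Prop. 14 p. 94] -/
theorem natCard_fixedPoints_unitaryInt_flickerTorusOne_eq_phiZero (hJ : J = (StdForm.antidiagonal 3).over K) (hd : LocalConjDatum σ ϖ)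
    (hσO : ∀ y : 𝒪[K], (σ.comp 𝒪[K].subtype) y ∈ 𝒪[K]) {y : K} (hy : y * σ y = -2)
    {c : ↥(unitaryGroupOfForm σ J)} (hc : ((c : GL (Fin 3) K) : Matrix (Fin 3) (Fin 3) K) = !![1, 0, 0; 0, -1, 0; 0, 0, 1])
    (u : ℕ → ↥(unitaryGroupOfForm σ J))
    (hum : ∀ m, ((u m : GL (Fin 3) K) : Matrix (Fin 3) (Fin 3) K) = !![ϖ ^ m, y, (ϖ ^ m)⁻¹; 0, 1, -σ y * (ϖ ^ m)⁻¹; 0, 0, (ϖ ^ m)⁻¹])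
    {R : Type u} [CommRing R] [IsDomain R] [IsDiscreteValuationRing R] [Finite (ResidueField R)] (ι : R →+* K) (hι : Function.Injective ι)
    (hιv : ∀ x : K, Valued.v x ≤ 1 ↔ x ∈ Set.range ι) (σR : R →+* R) (hσR : ∀ r, σR (σR r) = r) (hσι : ∀ r, ι (σR r) = σ (ι r))
    {dR : R} (hdRσ : σR dR = -dR) (hdRu : IsUnit dR) (h2R : IsUnit (2 : R)) {ϖR : R} (hϖR : Irreducible ϖR) (hιϖ : ι ϖR = ϖ)
    {q : ℕ} (hqR : Nat.card (ResidueField R) = q ^ 2) (hq : Nat.card (ResidueField 𝒪[K]) = q ^ 2)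
    {a₀ : 𝒪[K]} (ha₀ : IsUnit (((σ.comp 𝒪[K].subtype).codRestrict 𝒪[K] hσO) a₀ - a₀))
    {e a b cc : K} (h2e : 2 * e = 1) (ha : σ a * a = 1) (hb : σ b * b = 1) (hcc : σ cc * cc = 1)
    {t : ↥(unitaryGroupOfForm σ J)}
    (hte : ((t : GL (Fin 3) K) : Matrix (Fin 3) (Fin 3) K) = !![e * (a + cc), 0, -(e * (a - cc)); 0, b, 0; -(e * (a - cc)), 0, e * (a + cc)])
    (htH : t ∈ Subgroup.centralizer ({c} : Set ↥(unitaryGroupOfForm σ J)))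
    (r : ℕ → ↥(Subgroup.centralizer ({c} : Set ↥(unitaryGroupOfForm σ J))))
    (hr : ∀ i, (((r i : ↥(unitaryGroupOfForm σ J)) : GL (Fin 3) K) : Matrix (Fin 3) (Fin 3) K) = !![(ϖ ^ i)⁻¹, 0, 0; 0, 1, 0; 0, 0, ϖ ^ i])
    {N Np N₁ N₂ : ℕ} (hN : Valued.v (a - cc) = Valued.v (ϖ ^ N)) (hNp : Valued.v (a + cc - 2 * b) = Valued.v (ϖ ^ Np))
    (hN₁ : Valued.v (a - b) = Valued.v (ϖ ^ N₁)) (hN₂ : Valued.v (cc - b) = Valued.v (ϖ ^ N₂))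
    (h : (N₁ < N ∧ N₂ = N₁ ∧ Np = N₁) ∨ (N ≤ N₁ ∧ N ≤ Np))
    (hfin : {x : ↥(unitaryGroupOfForm σ J) ⧸ unitaryInt σ J | t • x = x}.Finite) :
    (Nat.card {x : ↥(unitaryGroupOfForm σ J) ⧸ unitaryInt σ J | t • x = x} : ℚ) = phiZero q N₁ N₂ N :=
  natCard_fixedPoints_unitaryInt_flickerTorusOne_eq_phiZero_of_bridge σ hJ hd hσO hy hc u hum ι hι hιv σR hσR hσι hdRσ hdRu h2R hϖR hιϖ hqR hq ha₀
    h2e ha hb hcc hte htH r hr hN hNp hN₁ hN₂ h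
    (fun m hNm hNNp hM2 h2M hpar hcrit => natCard_cosets_flickerTorusOne_case_e σ hJ hd hσO hy hc (hum m) h2e ha hb hcc hN hNp hN₁ hN₂ h hq ha₀
      hNm hNNp hM2 h2M hpar hcrit) hfin

end Complete

end UnitaryGroup

end Literature.NumberTheory.Automorphic
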